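import Literature.NumberTheory.CubicFields.CubicFieldDiscriminant3027
import HarnessLib

/-!
# The cubic field of discriminant `−3027` (LMFDB 3.1.3027.1), part 2: the primes of norm `≤ 15` are principal; CLASS NUMBER ONE — PROVED

Sequel of `CubicFieldDiscriminant3027.lean` (same seat, same namespace `Literature.NumberTheory.CubicFields.CubicDisc3027`; §1–§2 there: the polynomial,
`d_F = −3027`, `𝓞_F = ℤ[θ]`, signature).  THEOREMS ONLY; every statement PROVED.  §3: every prime of `𝓞_F` above `p ≤ 15` with `p^f ≤ 15` is
principal (explicit generators / inert primes, Dedekind–Kummer); §4: ★ `h_F = 1` by Minkowski (`(4/π)(3!/3³)√3027 ≈ 15.57 < 16`) and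
`not_two_dvd_classNumber`.  Written by the prover seat `bsd-line-att-p4` g38 (cell `bsd-f1-sign2`; g27's template) for the curve `[1,0,1,−19,29]` of conductor
`3027 = 3·1009` on the doors-dead sub-cell (u1/u7) of crux C2 — the datum «`h(ℚ(β)) = 1`» of att-p3's / att-p5's class-group doors.

References: [LMFDB] number field 3.1.3027.1 (class number 1); [Marcus2018] Ch. 3 Thm. 27, Ch. 5 Thm. 37 and Cor. 2.
-/

noncomputable section

open Polynomial NumberField NumberField.InfinitePlace Ideal Module Real
open Literature.NumberTheory.NumberFields
open Literature.NumberTheory.NumberFields.MonicCubic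

namespace Literature.NumberTheory.CubicFields.CubicDisc3027

section NumberField

variable {F : Type*} [Field F] [NumberField F] {α : F}

/-! ## §3 The primes of norm `≤ 15` are principal -/

/-- The cubic relation `θ³ + aθ² + bθ + c = 0` in `𝓞_F`, numerals pushed (private helper). [folklore] -/
private theorem theta_rel (hα : aeval α (poly (1) (7) (-6)) = 0) :
    thetaInt hα ^ 3 + (1) * thetaInt hα ^ 2 + (7) * thetaInt hα + (-6) = 0 := by
  have h := thetaInt_rel hα
  push_cast at h
  linear_combination h

/-- `(2, θ + 0) = (-2 + 2 * θ + θ ^ 2)` (an element of norm `±2`). [cite: Marcus2018, Ch. 3, Thm. 27] -/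
theorem span_2_lin0_eq (hα : aeval α (poly (1) (7) (-6)) = 0) :
    span {(2 : 𝓞 F), thetaInt hα} = span {-2 + 2 * thetaInt hα + thetaInt hα ^ 2} := by
  have hrel := theta_rel hα
  apply le_antisymm
  · rw [span_le]
    rintro x hx
    rcases hx with rfl | hx
    · exact mem_span_singleton'.mpr ⟨-91 - 19 * thetaInt hα - 11 * thetaInt hα ^ 2, by linear_combination (-30 - 11 * thetaInt hα) * hrel⟩
    · rw [Set.mem_singleton_iff.mp hx]
      exact mem_span_singleton'.mpr ⟨-33 - 7 * thetaInt hα - 4 * thetaInt hα ^ 2, by linear_combination (-11 - 4 * thetaInt hα) * hrel⟩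
  · rw [span_singleton_le_iff_mem, mem_span_pair]
    exact ⟨17 - 17 * thetaInt hα, -6 - 5 * thetaInt hα - 6 * thetaInt hα ^ 2, by linear_combination (-6) * hrel⟩

/-- `(2, θ² + 1θ + 1) = (-91 - 19 * θ - 11 * θ ^ 2)` (an element of norm `4`). [cite: Marcus2018, Ch. 3, Thm. 27] -/
theorem span_2_quad_eq (hα : aeval α (poly (1) (7) (-6)) = 0) :
    span {(2 : 𝓞 F), thetaInt hα ^ 2 + thetaInt hα + 1} = span {-91 - 19 * thetaInt hα - 11 * thetaInt hα ^ 2} := by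
  have hrel := theta_rel hα
  apply le_antisymm
  · rw [span_le]
    rintro x hx
    rcases hx with rfl | hx
    · exact mem_span_singleton'.mpr ⟨-2 + 2 * thetaInt hα + thetaInt hα ^ 2, by linear_combination (-30 - 11 * thetaInt hα) * hrel⟩
    · rw [Set.mem_singleton_iff.mp hx]
      exact mem_span_singleton'.mpr ⟨5 - 4 * thetaInt hα - 4 * thetaInt hα ^ 2, by linear_combination (76 + 44 * thetaInt hα) * hrel⟩
  · rw [span_singleton_le_iff_mem, mem_span_pair]
    exact ⟨-25 - 7 * thetaInt hα - 21 * thetaInt hα ^ 2, -5 - 6 * thetaInt hα - 6 * thetaInt hα ^ 2, by linear_combination (-6 - 6 * thetaInt hα) * hrel⟩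

/-- **Every prime of `𝓞_F` above `2` is principal** (Dedekind–Kummer with `polyMod_2` and the generators above).
[cite: Marcus2018, Ch. 3, Thm. 27] [cite: LMFDB, number field 3.1.3027.1 (class number 1)] -/
theorem isPrincipal_of_mem_primesOver_2 (h3 : finrank ℚ F = 3) (hα : aeval α (poly (1) (7) (-6)) = 0) {P : Ideal (𝓞 F)}
    (hP : P ∈ primesOver (span {((2 : ℕ) : ℤ)}) (𝓞 F)) : Submodule.IsPrincipal P := by
  haveI : Fact (Nat.Prime 2) := ⟨by norm_num⟩
  obtain ⟨Qb, hirr, hmon, hdvd, -, hspan⟩ :=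
    exists_factor_of_mem_primesOver irreducible_polyQ hα h3 isUnit_of_disc_eq_sq_mul (by norm_num : Nat.Prime 2) hP
  rw [polyMod_2] at hdvd
  rcases hirr.prime.dvd_or_dvd hdvd with h | h
  · have hQb : Qb = X := eq_of_monic_of_associated hmon monic_X (hirr.associated_of_dvd irreducible_X h)
    have hPeq := hspan X (by rw [hQb, Polynomial.map_X])
    rw [aeval_X, Nat.cast_ofNat, span_2_lin0_eq hα] at hPeq
    exact ⟨⟨-2 + 2 * thetaInt hα + thetaInt hα ^ 2, by rw [hPeq, Ideal.submodule_span_eq]⟩⟩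
  · have hQb : Qb = X ^ 2 + X + 1 :=
      eq_of_monic_of_associated hmon (by monicity!) (hirr.associated_of_dvd CubicDisc307.irreducible_quad_two h)
    have hPeq := hspan (X ^ 2 + X + 1) (by rw [hQb]; simp)
    rw [show aeval (thetaInt hα) (X ^ 2 + X + 1 : ℤ[X]) = thetaInt hα ^ 2 + thetaInt hα + 1 by
        simp only [map_add, map_pow, aeval_X, map_one], Nat.cast_ofNat, span_2_quad_eq hα] at hPeq
    exact ⟨⟨-91 - 19 * thetaInt hα - 11 * thetaInt hα ^ 2, by rw [hPeq, Ideal.submodule_span_eq]⟩⟩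

/-- `(3, θ + 0) = (-33 - 7 * θ - 4 * θ ^ 2)` (an element of norm `±3`). [cite: Marcus2018, Ch. 3, Thm. 27] -/
theorem span_3_lin0_eq (hα : aeval α (poly (1) (7) (-6)) = 0) :
    span {(3 : 𝓞 F), thetaInt hα} = span {-33 - 7 * thetaInt hα - 4 * thetaInt hα ^ 2} := by
  have hrel := theta_rel hα
  apply le_antisymm
  · rw [span_le]
    rintro x hx
    rcases hx with rfl | hx
    · exact mem_span_singleton'.mpr ⟨-1 + 2 * thetaInt hα - thetaInt hα ^ 2, by linear_combination (-5 + 4 * thetaInt hα) * hrel⟩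
    · rw [Set.mem_singleton_iff.mp hx]
      exact mem_span_singleton'.mpr ⟨-2 + 2 * thetaInt hα + thetaInt hα ^ 2, by linear_combination (-11 - 4 * thetaInt hα) * hrel⟩
  · rw [span_singleton_le_iff_mem, mem_span_pair]
    exact ⟨-1 - 12 * thetaInt hα - thetaInt hα ^ 2, -6 - 6 * thetaInt hα - 5 * thetaInt hα ^ 2, by linear_combination (-5) * hrel⟩

/-- `(3, θ + 2) = (-1 + θ)` (an element of norm `±3`). [cite: Marcus2018, Ch. 3, Thm. 27] -/
theorem span_3_lin2_eq (hα : aeval α (poly (1) (7) (-6)) = 0) :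
    span {(3 : 𝓞 F), thetaInt hα + 2} = span {-1 + thetaInt hα} := by
  have hrel := theta_rel hα
  apply le_antisymm
  · rw [span_le]
    rintro x hx
    rcases hx with rfl | hx
    · exact mem_span_singleton'.mpr ⟨-9 - 2 * thetaInt hα - thetaInt hα ^ 2, by linear_combination (-1) * hrel⟩
    · rw [Set.mem_singleton_iff.mp hx]
      exact mem_span_singleton'.mpr ⟨-8 - 2 * thetaInt hα - thetaInt hα ^ 2, by linear_combination (-1) * hrel⟩
  · rw [span_singleton_le_iff_mem, mem_span_pair]
    exact ⟨15 - 8 * thetaInt hα + 4 * thetaInt hα ^ 2, -5 - 6 * thetaInt hα - 6 * thetaInt hα ^ 2, by linear_combination (-6) * hrel⟩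

/-- **Every prime of `𝓞_F` above `3` is principal** (Dedekind–Kummer with `polyMod_3` and the generators above).
[cite: Marcus2018, Ch. 3, Thm. 27] [cite: LMFDB, number field 3.1.3027.1 (class number 1)] -/
theorem isPrincipal_of_mem_primesOver_3 (h3 : finrank ℚ F = 3) (hα : aeval α (poly (1) (7) (-6)) = 0) {P : Ideal (𝓞 F)}
    (hP : P ∈ primesOver (span {((3 : ℕ) : ℤ)}) (𝓞 F)) : Submodule.IsPrincipal P := by
  haveI : Fact (Nat.Prime 3) := ⟨by norm_num⟩
  obtain ⟨Qb, hirr, hmon, hdvd, -, hspan⟩ :=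
    exists_factor_of_mem_primesOver irreducible_polyQ hα h3 isUnit_of_disc_eq_sq_mul (by norm_num : Nat.Prime 3) hP
  rw [polyMod_3] at hdvd
  rcases hirr.prime.dvd_or_dvd hdvd with h12 | h
  · rcases hirr.prime.dvd_or_dvd h12 with h | h
    · have hQb : Qb = X := eq_of_monic_of_associated hmon monic_X (hirr.associated_of_dvd irreducible_X h)
      have hPeq := hspan X (by rw [hQb, Polynomial.map_X])
      rw [aeval_X, Nat.cast_ofNat, span_3_lin0_eq hα] at hPeq
      exact ⟨⟨-33 - 7 * thetaInt hα - 4 * thetaInt hα ^ 2, by rw [hPeq, Ideal.submodule_span_eq]⟩⟩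
    · have hirr1 : Irreducible (X + 2 : (ZMod 3)[X]) := by
        rw [show (X + 2 : (ZMod 3)[X]) = X - C (-2) by rw [map_neg, map_ofNat]; ring]
        exact irreducible_X_sub_C _
      have hQb : Qb = X + 2 := eq_of_monic_of_associated hmon (by monicity!) (hirr.associated_of_dvd hirr1 h)
      have hPeq := hspan (X + C 2) (by rw [hQb]; simp [map_ofNat])
      rw [show aeval (thetaInt hα) (X + C 2 : ℤ[X]) = thetaInt hα + 2 by
          simp only [map_add, aeval_X, aeval_C, algebraMap_int_eq, Int.coe_castRingHom, Int.cast_ofNat], Nat.cast_ofNat, span_3_lin2_eq hα] at hPeq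
      exact ⟨⟨-1 + thetaInt hα, by rw [hPeq, Ideal.submodule_span_eq]⟩⟩
  · have hirr1 : Irreducible (X + 2 : (ZMod 3)[X]) := by
      rw [show (X + 2 : (ZMod 3)[X]) = X - C (-2) by rw [map_neg, map_ofNat]; ring]
      exact irreducible_X_sub_C _
    have hQb : Qb = X + 2 := eq_of_monic_of_associated hmon (by monicity!) (hirr.associated_of_dvd hirr1 h)
    have hPeq := hspan (X + C 2) (by rw [hQb]; simp [map_ofNat])
    rw [show aeval (thetaInt hα) (X + C 2 : ℤ[X]) = thetaInt hα + 2 by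
        simp only [map_add, aeval_X, aeval_C, algebraMap_int_eq, Int.coe_castRingHom, Int.cast_ofNat], Nat.cast_ofNat, span_3_lin2_eq hα] at hPeq
    exact ⟨⟨-1 + thetaInt hα, by rw [hPeq, Ideal.submodule_span_eq]⟩⟩

/-- `(5, θ + 3) = (-7 + 6 * θ + 5 * θ ^ 2)` (an element of norm `±5`). [cite: Marcus2018, Ch. 3, Thm. 27] -/
theorem span_5_lin3_eq (hα : aeval α (poly (1) (7) (-6)) = 0) :
    span {(5 : 𝓞 F), thetaInt hα + 3} = span {-7 + 6 * thetaInt hα + 5 * thetaInt hα ^ 2} := by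
  have hrel := theta_rel hα
  apply le_antisymm
  · rw [span_le]
    rintro x hx
    rcases hx with rfl | hx
    · exact mem_span_singleton'.mpr ⟨1783 + 373 * thetaInt hα + 216 * thetaInt hα ^ 2, by linear_combination (2081 + 1080 * thetaInt hα) * hrel⟩
    · rw [Set.mem_singleton_iff.mp hx]
      exact mem_span_singleton'.mpr ⟨1329 + 278 * thetaInt hα + 161 * thetaInt hα ^ 2, by linear_combination (1551 + 805 * thetaInt hα) * hrel⟩
  · rw [span_singleton_le_iff_mem, mem_span_pair]
    exact ⟨7 - 2 * thetaInt hα + 3 * thetaInt hα ^ 2, -6 - 2 * thetaInt hα - 4 * thetaInt hα ^ 2, by linear_combination (-4) * hrel⟩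

/-- **Every prime of `𝓞_F` above `5` with `5^f ≤ 15` is principal** (Dedekind–Kummer with `polyMod_5` and the generators above).
[cite: Marcus2018, Ch. 3, Thm. 27] [cite: LMFDB, number field 3.1.3027.1 (class number 1)] -/
theorem isPrincipal_of_mem_primesOver_5 (h3 : finrank ℚ F = 3) (hα : aeval α (poly (1) (7) (-6)) = 0) {P : Ideal (𝓞 F)}
    (hP : P ∈ primesOver (span {((5 : ℕ) : ℤ)}) (𝓞 F))
    (hle : 5 ^ P.inertiaDeg ℤ ≤ 15) : Submodule.IsPrincipal P := by
  haveI : Fact (Nat.Prime 5) := ⟨by norm_num⟩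
  obtain ⟨Qb, hirr, hmon, hdvd, hdeg, hspan⟩ :=
    exists_factor_of_mem_primesOver irreducible_polyQ hα h3 isUnit_of_disc_eq_sq_mul (by norm_num : Nat.Prime 5) hP
  rw [polyMod_5] at hdvd
  rcases hirr.prime.dvd_or_dvd hdvd with h | h
  · have hirr1 : Irreducible (X + 3 : (ZMod 5)[X]) := by
      rw [show (X + 3 : (ZMod 5)[X]) = X - C (-3) by rw [map_neg, map_ofNat]; ring]
      exact irreducible_X_sub_C _
    have hQb : Qb = X + 3 := eq_of_monic_of_associated hmon (by monicity!) (hirr.associated_of_dvd hirr1 h)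
    have hPeq := hspan (X + C 3) (by rw [hQb]; simp [map_ofNat])
    rw [show aeval (thetaInt hα) (X + C 3 : ℤ[X]) = thetaInt hα + 3 by
        simp only [map_add, aeval_X, aeval_C, algebraMap_int_eq, Int.coe_castRingHom, Int.cast_ofNat], Nat.cast_ofNat, span_5_lin3_eq hα] at hPeq
    exact ⟨⟨-7 + 6 * thetaInt hα + 5 * thetaInt hα ^ 2, by rw [hPeq, Ideal.submodule_span_eq]⟩⟩
  · have hQb : Qb = X ^ 2 + 3 * X + 3 :=
      eq_of_monic_of_associated hmon (by monicity!) (hirr.associated_of_dvd irreducible_quad_5 h)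
    exfalso
    have hd2 : (X ^ 2 + 3 * X + 3 : (ZMod 5)[X]).natDegree = 2 := by compute_degree!
    rw [hdeg, hQb, hd2] at hle
    norm_num at hle

/-- **Every prime of `𝓞_F` above `7` is principal**: `7` is inert, the prime is `(7)`. [cite: Marcus2018, Ch. 3, Thm. 27] -/
theorem isPrincipal_of_mem_primesOver_7 (h3 : finrank ℚ F = 3) (hα : aeval α (poly (1) (7) (-6)) = 0) {P : Ideal (𝓞 F)}
    (hP : P ∈ primesOver (span {((7 : ℕ) : ℤ)}) (𝓞 F)) : Submodule.IsPrincipal P := by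
  have hPeq := eq_span_of_no_root irreducible_polyQ hα h3 isUnit_of_disc_eq_sq_mul (by norm_num : Nat.Prime 7) hP no_root_7
  exact ⟨⟨((7 : ℕ) : 𝓞 F), by rw [hPeq, Ideal.submodule_span_eq]⟩⟩

/-- `f` has no root modulo `11`: `11` is inert. [cite: Marcus2018, Ch. 3, Thm. 27] -/
theorem no_root_11' : ∀ r : ZMod 11, r ^ 3 + ((1 : ℤ) : ZMod 11) * r ^ 2 + ((7 : ℤ) : ZMod 11) * r + ((-6 : ℤ) : ZMod 11) ≠ 0 := by
  decide

/-- **Every prime of `𝓞_F` above `11` is principal**: `11` is inert, the prime is `(11)`. [cite: Marcus2018, Ch. 3, Thm. 27] -/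
theorem isPrincipal_of_mem_primesOver_11 (h3 : finrank ℚ F = 3) (hα : aeval α (poly (1) (7) (-6)) = 0) {P : Ideal (𝓞 F)}
    (hP : P ∈ primesOver (span {((11 : ℕ) : ℤ)}) (𝓞 F)) : Submodule.IsPrincipal P := by
  have hPeq := eq_span_of_no_root irreducible_polyQ hα h3 isUnit_of_disc_eq_sq_mul (by norm_num : Nat.Prime 11) hP no_root_11'
  exact ⟨⟨((11 : ℕ) : 𝓞 F), by rw [hPeq, Ideal.submodule_span_eq]⟩⟩

/-- `(13, θ + 1) = (-1 - θ)` (an element of norm `±13`). [cite: Marcus2018, Ch. 3, Thm. 27] -/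
theorem span_13_lin1_eq (hα : aeval α (poly (1) (7) (-6)) = 0) :
    span {(13 : 𝓞 F), thetaInt hα + 1} = span {-1 - thetaInt hα} := by
  have hrel := theta_rel hα
  apply le_antisymm
  · rw [span_le]
    rintro x hx
    rcases hx with rfl | hx
    · exact mem_span_singleton'.mpr ⟨-7 - thetaInt hα ^ 2, by linear_combination (1) * hrel⟩
    · rw [Set.mem_singleton_iff.mp hx]
      exact mem_span_singleton'.mpr ⟨-1, by linear_combination ((0 : 𝓞 F)) * hrel⟩
  · rw [span_singleton_le_iff_mem, mem_span_pair]
    exact ⟨-1 + 2 * thetaInt hα, -6 + 3 * thetaInt hα ^ 2, by linear_combination (3) * hrel⟩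

/-- **Every prime of `𝓞_F` above `13` with `13^f ≤ 15` is principal** (Dedekind–Kummer with `polyMod_13` and the generators above).
[cite: Marcus2018, Ch. 3, Thm. 27] [cite: LMFDB, number field 3.1.3027.1 (class number 1)] -/
theorem isPrincipal_of_mem_primesOver_13 (h3 : finrank ℚ F = 3) (hα : aeval α (poly (1) (7) (-6)) = 0) {P : Ideal (𝓞 F)}
    (hP : P ∈ primesOver (span {((13 : ℕ) : ℤ)}) (𝓞 F))
    (hle : 13 ^ P.inertiaDeg ℤ ≤ 15) : Submodule.IsPrincipal P := by
  haveI : Fact (Nat.Prime 13) := ⟨by norm_num⟩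
  obtain ⟨Qb, hirr, hmon, hdvd, hdeg, hspan⟩ :=
    exists_factor_of_mem_primesOver irreducible_polyQ hα h3 isUnit_of_disc_eq_sq_mul (by norm_num : Nat.Prime 13) hP
  rw [polyMod_13] at hdvd
  rcases hirr.prime.dvd_or_dvd hdvd with h | h
  · have hirr1 : Irreducible (X + 1 : (ZMod 13)[X]) := by
      rw [show (X + 1 : (ZMod 13)[X]) = X - C (-1) by rw [map_neg, map_one, sub_neg_eq_add]]
      exact irreducible_X_sub_C _
    have hQb : Qb = X + 1 := eq_of_monic_of_associated hmon (by monicity!) (hirr.associated_of_dvd hirr1 h)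
    have hPeq := hspan (X + 1) (by rw [hQb]; simp)
    rw [show aeval (thetaInt hα) (X + 1 : ℤ[X]) = thetaInt hα + 1 by
        simp only [map_add, aeval_X, map_one], Nat.cast_ofNat, span_13_lin1_eq hα] at hPeq
    exact ⟨⟨-1 - thetaInt hα, by rw [hPeq, Ideal.submodule_span_eq]⟩⟩
  · have hQb : Qb = X ^ 2 + 7 :=
      eq_of_monic_of_associated hmon (by monicity!) (hirr.associated_of_dvd irreducible_quad_13 h)
    exfalso
    have hd2 : (X ^ 2 + 7 : (ZMod 13)[X]).natDegree = 2 := by compute_degree!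
    rw [hdeg, hQb, hd2] at hle
    norm_num at hle

/-! ## §4 Class number one -/

/-- **`𝓞_F` is a principal ideal domain.**  Minkowski: every ideal class contains an ideal of norm
`≤ (4/π)(6/27)√3027 < 16`, and the primes `P` above `p ≤ 15` with `p^f ≤ 15` are principal (§3).
[cite: LMFDB, number field 3.1.3027.1 (class number 1)] [cite: Marcus2018, Ch. 5, Thm. 37 and Cor. 2] -/
theorem isPrincipalIdealRing (h3 : finrank ℚ F = 3) (hα : aeval α (poly (1) (7) (-6)) = 0) : IsPrincipalIdealRing (𝓞 F) := by
  apply RingOfIntegers.isPrincipalIdealRing_of_isPrincipal_of_pow_le_of_mem_primesOver_of_mem_Icc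
  rw [nrComplexPlaces_eq_one h3 hα, h3, discr_eq h3 hα]
  intro p hp hpr P hP hle
  obtain ⟨hp1, hpM⟩ := Finset.mem_Icc.mp hp
  have hreal : (4 / π) ^ 1 * ((((3 : ℕ).factorial : ℕ) : ℝ) / ((3 : ℕ) : ℝ) ^ (3 : ℕ) * √|((-3027 : ℤ) : ℝ)|) < ((16 : ℕ) : ℝ) := by
    have hπ := Real.pi_gt_d2
    have hπ0 := Real.pi_pos
    have hs : √(3027 : ℝ) < 55.02 := by
      rw [Real.sqrt_lt' (by norm_num)]; norm_num
    have hs0 : 0 ≤ √(3027 : ℝ) := Real.sqrt_nonneg _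
    have habs : |((-3027 : ℤ) : ℝ)| = 3027 := by norm_num
    rw [habs]
    norm_num [Nat.factorial]
    rw [div_mul_eq_mul_div, div_lt_iff₀ hπ0]
    nlinarith
  have hfl := Nat.lt_succ_iff.mp ((Nat.floor_lt' (by norm_num)).mpr hreal)
  have hpB : p ≤ 15 := hpM.trans hfl
  have hleB : p ^ P.inertiaDeg ℤ ≤ 15 := hle.trans hfl
  clear hpM hle hp
  interval_cases p
  · exact absurd hpr (by norm_num)
  · exact isPrincipal_of_mem_primesOver_2 h3 hα hP
  · exact isPrincipal_of_mem_primesOver_3 h3 hα hP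
  · exact absurd hpr (by norm_num)
  · exact isPrincipal_of_mem_primesOver_5 h3 hα hP hleB
  · exact absurd hpr (by norm_num)
  · exact isPrincipal_of_mem_primesOver_7 h3 hα hP
  · exact absurd hpr (by norm_num)
  · exact absurd hpr (by norm_num)
  · exact absurd hpr (by norm_num)
  · exact isPrincipal_of_mem_primesOver_11 h3 hα hP
  · exact absurd hpr (by norm_num)
  · exact isPrincipal_of_mem_primesOver_13 h3 hα hP hleB
  · exact absurd hpr (by norm_num)
  · exact absurd hpr (by norm_num)

/-- ★ **`h_F = 1`: the cubic field of discriminant `−3027` has class number one.** [cite: LMFDB, number field 3.1.3027.1 (class number 1)] -/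
theorem classNumber_eq_one (h3 : finrank ℚ F = 3) (hα : aeval α (poly (1) (7) (-6)) = 0) : classNumber F = 1 :=
  (classNumber_eq_one_iff (K := F)).mpr (isPrincipalIdealRing h3 hα)

/-- **`h_F` is odd** (the form consumed by the `2`-adic doors of cell `bsd-f1-sign2`). [cite: LMFDB, number field 3.1.3027.1 (class number 1)] -/
theorem not_two_dvd_classNumber (h3 : finrank ℚ F = 3) (hα : aeval α (poly (1) (7) (-6)) = 0) : ¬ 2 ∣ classNumber F := by
  rw [classNumber_eq_one h3 hα]; decide

end NumberField

end Literature.NumberTheory.CubicFields.CubicDisc3027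

end
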